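import Summits.QuantumFields.YangMills.Theorems.F4SubCurvatureDoorShortRootRigidityTorusLadder
import Mathlib
import HarnessLib

/-!
# TorusReduction, part (TR4a): slicing a polynomial on `ℝ⁴` at `x₀ = 0` — coefficient calculus, Cauchy–Kovalevskaya
# uniqueness, and the `x₀¹`-coefficient of the rotation generator

Crux ⟨stmt-QuantumFields-23035⟩ `F4SubCurvatureDoor.ShortRootRigidity`, stub `:146 stub_oddModeRigidity`, piece `TorusReduction`
(`Cruxes/ShortRootRigidity/Lines/odd_mode_split.lean`).  We read `P ∈ ℝ[x₀,x₁,x₂,x₃]` as a polynomial in `x₀` with coefficients in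
`P3 = ℝ[x₁,x₂,x₃]` through Mathlib's `finSuccEquiv ℝ 3`; `(finSuccEquiv ℝ 3 P).coeff k` is the `x₀ᵏ`-coefficient and `k = 0` is the SLICE
`P|_{x₀=0}` (also `= aeval (Fin.cons 0 X) P`, `slice_eq_aeval`).  Results:

* coefficient calculus: `coeff_fse_pderiv_succ` (`∂ⱼ` commutes with taking `x₀ᵏ`-coefficients), `coeff_fse_pderiv_zero`
  (`(∂₀P)_k = (k+1) P_{k+1}`), `coeff_fse_laplacian` (`(Δ₄P)_k = (k+1)(k+2) P_{k+2} + Δ₃ P_k`);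
* `eq_zero_of_harmonic_of_coeff_zero_one` — CK uniqueness: a harmonic `P` with `P₀ = P₁ = 0` is `0`;
* `eval_coeff_zero`, `slice_eq_aeval`, `isHomogeneous_coeff_zero`, `coeff_zero_bind₁_linSubst` (slice of `P ∘ S` for a block matrix
  `S = 1 ⊕ Rf`), `coeff_one_eq_zero_of_even` (an `x₀`-even `P` has `P₁ = 0`);
* `slice_pde_of_generator` — if `Δ₄A = 0` and the rational rotation generator kills `A`, `x₀·(∂₁+∂₂+∂₃)A − (x₁+x₂+x₃)·∂₀A = 0`, then the
  slice `a = A₀` satisfies the 3D PDE `(Σxᵢ)·Δ₃a + (Σ∂ᵢ)a = 0` of the TorusReduction route.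

Mathlib + tree only; no `sorry`; no new definitions.  HONEST LABEL: bookkeeping for one piece of the OPEN stub `:146`; ⟨23035⟩, ⟨23125⟩,
R2d and the Yang–Mills mass gap remain OPEN; no summit is proved by a line.  LEAD seat `ym-line-sfw-p2` g76 (cell ym-idea-1, free hands).
-/

noncomputable section

open MvPolynomial
open scoped BigOperators

namespace Summit.QuantumFields.YangMills.Theorems.F4SubCurvatureDoorTorus

open Literature.Analysis.Calculus.MvPoly (lap)
open Literature.Algebra.Polynomial (linSubst eval_bind₁_linSubst pderiv_bind₁_linSubst)
open Summit.QuantumFields.YangMills.Theorems.F4SubCurvatureDoorTrigonalLine (P3 Rf)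

/-! ## Coefficient calculus for `finSuccEquiv ℝ 3` -/

/-- `Finsupp.cons` and adding a unit vector in a later slot commute. -/
theorem cons_add_single_succ (m : Fin 3 →₀ ℕ) (k : ℕ) (j : Fin 3) :
    (m + Finsupp.single j 1).cons k = m.cons k + Finsupp.single (Fin.succ j) 1 := by
  ext i
  refine Fin.cases ?_ (fun i' => ?_) i
  · simp [Finsupp.cons_zero]
  · simp only [Finsupp.cons_succ, Finsupp.coe_add, Pi.add_apply, Finsupp.single_apply]
    by_cases h : j = i'
    · subst h; simp
    · simp [h, (Fin.succ_injective 3).ne h]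

/-- Adding a unit vector in slot `0` raises the `cons`-head. -/
theorem cons_add_single_zero (m : Fin 3 →₀ ℕ) (k : ℕ) :
    (m.cons k : Fin 4 →₀ ℕ) + Finsupp.single 0 1 = m.cons (k + 1) := by
  ext i
  refine Fin.cases ?_ (fun i' => ?_) i
  · simp [Finsupp.cons_zero]
  · simp [Finsupp.cons_succ, (Fin.succ_ne_zero i')]

/-- **`∂ⱼ` commutes with `x₀ᵏ`-coefficients**: `(finSuccEquiv (∂_{j+1} P)).coeff k = ∂ⱼ ((finSuccEquiv P).coeff k)`. -/
theorem coeff_fse_pderiv_succ (P : MvPolynomial (Fin 4) ℝ) (j : Fin 3) (k : ℕ) :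
    (finSuccEquiv ℝ 3 (pderiv (Fin.succ j) P)).coeff k = pderiv j ((finSuccEquiv ℝ 3 P).coeff k) := by
  refine MvPolynomial.ext _ _ fun m => ?_
  rw [finSuccEquiv_coeff_coeff, coeff_pderiv, coeff_pderiv, finSuccEquiv_coeff_coeff, cons_add_single_succ]
  simp [Finsupp.cons_succ]

/-- **`(∂₀P)_k = (k+1)·P_{k+1}`**. -/
theorem coeff_fse_pderiv_zero (P : MvPolynomial (Fin 4) ℝ) (k : ℕ) :
    (finSuccEquiv ℝ 3 (pderiv 0 P)).coeff k = ((k : ℝ) + 1) • (finSuccEquiv ℝ 3 P).coeff (k + 1) := by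
  refine MvPolynomial.ext _ _ fun m => ?_
  rw [finSuccEquiv_coeff_coeff, coeff_pderiv, coeff_smul, finSuccEquiv_coeff_coeff, cons_add_single_zero]
  simp [Finsupp.cons_zero, mul_comm]

/-- `finSuccEquiv` of a finite sum, coefficientwise. -/
theorem coeff_fse_sum {ι : Type*} (t : Finset ι) (f : ι → MvPolynomial (Fin 4) ℝ) (k : ℕ) :
    (finSuccEquiv ℝ 3 (∑ i ∈ t, f i)).coeff k = ∑ i ∈ t, (finSuccEquiv ℝ 3 (f i)).coeff k := by
  rw [map_sum, Polynomial.finsetSum_coeff]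

/-- **`(Δ₄ P)_k = (k+1)(k+2)·P_{k+2} + Δ₃ P_k`**. -/
theorem coeff_fse_laplacian (P : MvPolynomial (Fin 4) ℝ) (k : ℕ) :
    (finSuccEquiv ℝ 3 (∑ i : Fin 4, pderiv i (pderiv i P))).coeff k =
      (((k : ℝ) + 1) * ((k : ℝ) + 2)) • (finSuccEquiv ℝ 3 P).coeff (k + 2) + lap ((finSuccEquiv ℝ 3 P).coeff k) := by
  rw [coeff_fse_sum, Fin.sum_univ_succ, coeff_fse_pderiv_zero, coeff_fse_pderiv_zero, smul_smul]
  simp_rw [coeff_fse_pderiv_succ]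
  congr 1
  · congr 1
    push_cast
    ring

/-! ## Cauchy–Kovalevskaya uniqueness for polynomials -/

/-- **CK uniqueness**: a harmonic polynomial on `ℝ⁴` whose `x₀⁰`- and `x₀¹`-coefficients vanish is zero. -/
theorem eq_zero_of_harmonic_of_coeff_zero_one (P : MvPolynomial (Fin 4) ℝ) (hharm : ∑ i : Fin 4, pderiv i (pderiv i P) = 0)
    (h0 : (finSuccEquiv ℝ 3 P).coeff 0 = 0) (h1 : (finSuccEquiv ℝ 3 P).coeff 1 = 0) : P = 0 := by
  have hrec : ∀ k, (finSuccEquiv ℝ 3 P).coeff (k + 2) =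
      -((((k : ℝ) + 1) * ((k : ℝ) + 2))⁻¹ • lap ((finSuccEquiv ℝ 3 P).coeff k)) := by
    intro k
    have h := coeff_fse_laplacian P k
    rw [hharm, map_zero, Polynomial.coeff_zero] at h
    have hc : ((k : ℝ) + 1) * ((k : ℝ) + 2) ≠ 0 := by positivity
    have h2 : (((k : ℝ) + 1) * ((k : ℝ) + 2)) • (finSuccEquiv ℝ 3 P).coeff (k + 2) = -lap ((finSuccEquiv ℝ 3 P).coeff k) :=
      eq_neg_of_add_eq_zero_left h.symm
    rw [← smul_neg, ← h2, smul_smul, inv_mul_cancel₀ hc, one_smul]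
  have hall : ∀ k, (finSuccEquiv ℝ 3 P).coeff k = 0 := by
    intro k
    induction k using Nat.strong_induction_on with
    | _ k ih =>
      rcases k with _ | k
      · exact h0
      rcases k with _ | k
      · exact h1
      rw [hrec k, ih k (by omega), Literature.Analysis.Calculus.MvPoly.lap_zero, smul_zero, neg_zero]
  have hP : finSuccEquiv ℝ 3 P = 0 := Polynomial.ext fun k => by rw [hall k, Polynomial.coeff_zero]
  exact (finSuccEquiv ℝ 3).injective (by rw [hP, map_zero])

/-! ## The slice: evaluation, the `aeval` form, homogeneity -/

/-- **Evaluation of the slice**: `P₀(y) = P(0, y)`. -/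
theorem eval_coeff_zero (P : MvPolynomial (Fin 4) ℝ) (y : Fin 3 → ℝ) :
    eval y ((finSuccEquiv ℝ 3 P).coeff 0) = eval (Fin.cons 0 y) P := by
  rw [eval_eq_eval_mv_eval', ← Polynomial.coeff_zero_eq_eval_zero, Polynomial.coeff_map]

/-- Evaluation of the substitution `x₀ ↦ 0`, `x_{j+1} ↦ x_j`. -/
theorem eval_aeval_cons_zero (P : MvPolynomial (Fin 4) ℝ) (y : Fin 3 → ℝ) :
    eval y (aeval (Fin.cons (0 : P3) fun j : Fin 3 => (X j : P3)) P) = eval (Fin.cons 0 y) P := by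
  rw [aeval_eq_bind₁]
  change aeval y (bind₁ (Fin.cons (0 : P3) fun j : Fin 3 => (X j : P3)) P) = _
  rw [aeval_bind₁, aeval_eq_eval]
  have hF : (fun i : Fin 4 => aeval y ((Fin.cons (0 : P3) (fun j : Fin 3 => (X j : P3)) : Fin 4 → P3) i)) =
      (Fin.cons (0 : ℝ) y : Fin 4 → ℝ) := by
    funext i
    refine Fin.cases ?_ (fun j => ?_) i
    · simp
    · simp
  rw [hF]

/-- **The slice is the substitution `x₀ ↦ 0`** (re-indexed): `aeval (Fin.cons 0 X) P = (finSuccEquiv P).coeff 0`. -/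
theorem slice_eq_aeval (P : MvPolynomial (Fin 4) ℝ) :
    aeval (Fin.cons (0 : P3) fun j : Fin 3 => (X j : P3)) P = (finSuccEquiv ℝ 3 P).coeff 0 :=
  MvPolynomial.funext fun y => by rw [eval_aeval_cons_zero, eval_coeff_zero]

/-- The slice of a homogeneous polynomial is homogeneous of the same degree. -/
theorem isHomogeneous_coeff_zero {P : MvPolynomial (Fin 4) ℝ} {n : ℕ} (hP : P.IsHomogeneous n) :
    ((finSuccEquiv ℝ 3 P).coeff 0).IsHomogeneous n := by
  rw [← slice_eq_aeval]
  have h := hP.eval₂ (C : ℝ →+* P3) (Fin.cons (0 : P3) fun j : Fin 3 => (X j : P3)) (fun r => isHomogeneous_C _ r)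
    (fun i => by
      refine Fin.cases ?_ (fun j => ?_) i
      · simpa using isHomogeneous_zero (Fin 3) ℝ 1
      · simpa using isHomogeneous_X ℝ j)
  rw [one_mul] at h
  rw [aeval_def, algebraMap_eq]
  exact h

/-! ## Slices of substitutions by a block matrix `1 ⊕ M` -/

/-- **Slice of `P ∘ S`** for a matrix `S` acting as `1 ⊕ M` on `ℝ ⊕ ℝ³`: `(P∘S)₀ = P₀ ∘ M`. -/
theorem coeff_zero_bind₁_linSubst (P : MvPolynomial (Fin 4) ℝ) (S : Matrix (Fin 4) (Fin 4) ℝ) (M : Matrix (Fin 3) (Fin 3) ℝ)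
    (hS : ∀ (t : ℝ) (y : Fin 3 → ℝ), S.mulVec (Fin.cons t y) = Fin.cons t (M.mulVec y)) :
    (finSuccEquiv ℝ 3 (bind₁ (linSubst S) P)).coeff 0 = bind₁ (linSubst M) ((finSuccEquiv ℝ 3 P).coeff 0) := by
  refine MvPolynomial.funext fun y => ?_
  rw [eval_coeff_zero, eval_bind₁_linSubst, hS, eval_bind₁_linSubst, eval_coeff_zero]

/-! ## Evenness in `x₀` kills the `x₀¹`-coefficient -/

/-- If `P(−x₀, x⃗) = P(x₀, x⃗)` pointwise then `P₁ = 0`. -/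
theorem coeff_one_eq_zero_of_even (P : MvPolynomial (Fin 4) ℝ)
    (heven : ∀ x : Fin 4 → ℝ, eval (fun i => if i = 0 then -x i else x i) P = eval x P) :
    (finSuccEquiv ℝ 3 P).coeff 1 = 0 := by
  -- the time flip as a linear substitution
  set T : Matrix (Fin 4) (Fin 4) ℝ := Matrix.diagonal fun i => if i = 0 then -1 else 1 with hT
  have hTv : ∀ x : Fin 4 → ℝ, T.mulVec x = fun i => if i = 0 then -x i else x i := by
    intro x; funext i; simp only [hT, Matrix.mulVec_diagonal]; split_ifs <;> ring
  have hfix : bind₁ (linSubst T) P = P := MvPolynomial.funext fun x => by rw [eval_bind₁_linSubst, hTv, heven]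
  -- `∂₀P` is odd under the flip
  have hodd : pderiv 0 P = -bind₁ (linSubst T) (pderiv 0 P) := by
    conv_lhs => rw [← hfix]
    rw [pderiv_bind₁_linSubst, Finset.sum_eq_single 0]
    · simp [hT]
    · intro a _ ha; simp [hT, Matrix.diagonal_apply_ne _ ha]
    · intro h; exact absurd (Finset.mem_univ 0) h
  -- so `∂₀P` vanishes on the slice
  have hslice : (finSuccEquiv ℝ 3 (pderiv 0 P)).coeff 0 = 0 := by
    refine MvPolynomial.funext fun y => ?_
    rw [eval_coeff_zero, map_zero]
    have h := congrArg (eval (Fin.cons 0 y)) hodd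
    rw [map_neg, eval_bind₁_linSubst, hTv] at h
    have hpt : (fun i => if i = 0 then -(Fin.cons (0 : ℝ) y : Fin 4 → ℝ) i else (Fin.cons (0 : ℝ) y : Fin 4 → ℝ) i) =
        (Fin.cons 0 y : Fin 4 → ℝ) := by
      funext i
      refine Fin.cases ?_ (fun j => ?_) i
      · simp
      · simp [Fin.succ_ne_zero]
    rw [hpt] at h
    linarith
  have h := coeff_fse_pderiv_zero P 0
  rw [hslice, Nat.cast_zero, zero_add, one_smul] at h
  exact h.symm

/-! ## The `x₀¹`-coefficient of the rotation generator -/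

/-- `finSuccEquiv` turns multiplication by `x₀` into multiplication by the polynomial variable. -/
theorem coeff_fse_X_zero_mul_succ (Q : MvPolynomial (Fin 4) ℝ) (k : ℕ) :
    (finSuccEquiv ℝ 3 (X 0 * Q)).coeff (k + 1) = (finSuccEquiv ℝ 3 Q).coeff k := by
  rw [map_mul, finSuccEquiv_X_zero, Polynomial.coeff_X_mul]

/-- `finSuccEquiv` turns multiplication by `x_{j+1}` into multiplication of the coefficients by `x_j`. -/
theorem coeff_fse_X_succ_mul (Q : MvPolynomial (Fin 4) ℝ) (j : Fin 3) (k : ℕ) :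
    (finSuccEquiv ℝ 3 (X (Fin.succ j) * Q)).coeff k = X j * (finSuccEquiv ℝ 3 Q).coeff k := by
  rw [map_mul, finSuccEquiv_X_succ, Polynomial.coeff_C_mul]

/-- **The slice PDE.**  If `Δ₄ A = 0` and the rational generator of the rotations of the plane `span(e₀, (0,1,1,1))` kills `A`,
`x₀·(∂₁+∂₂+∂₃)A − (x₁+x₂+x₃)·∂₀A = 0`, then the slice `a = A|_{x₀=0}` satisfies `(Σxᵢ)·Δ₃a + (Σ∂ᵢ)a = 0`
(the `x₀¹`-coefficient of the generator identity, with `2A₂ = −Δ₃A₀`). -/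
theorem slice_pde_of_generator (A : MvPolynomial (Fin 4) ℝ) (hharm : ∑ i : Fin 4, pderiv i (pderiv i A) = 0)
    (hgen : X 0 * (∑ j : Fin 3, pderiv (Fin.succ j) A) - (∑ j : Fin 3, X (Fin.succ j)) * pderiv 0 A = 0) :
    (∑ j : Fin 3, X j) * lap ((finSuccEquiv ℝ 3 A).coeff 0) + ∑ j : Fin 3, pderiv j ((finSuccEquiv ℝ 3 A).coeff 0) = 0 := by
  -- harmonicity at `x₀⁰`: `2 A₂ = −Δ₃ A₀`
  have h2 : ((2 : ℝ)) • (finSuccEquiv ℝ 3 A).coeff 2 = -lap ((finSuccEquiv ℝ 3 A).coeff 0) := by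
    have h := coeff_fse_laplacian A 0
    rw [hharm, map_zero, Polynomial.coeff_zero] at h
    norm_num at h
    exact eq_neg_of_add_eq_zero_left h.symm
  -- the `x₀¹`-coefficient of the generator identity
  have e1 : (finSuccEquiv ℝ 3 (X 0 * ∑ j : Fin 3, pderiv (Fin.succ j) A)).coeff 1 =
      ∑ j : Fin 3, pderiv j ((finSuccEquiv ℝ 3 A).coeff 0) := by
    have e := coeff_fse_X_zero_mul_succ (∑ j : Fin 3, pderiv (Fin.succ j) A) 0
    rw [zero_add] at e
    rw [e, coeff_fse_sum]
    exact Finset.sum_congr rfl fun j _ => coeff_fse_pderiv_succ A j 0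
  have e2 : (finSuccEquiv ℝ 3 ((∑ j : Fin 3, X (Fin.succ j)) * pderiv 0 A)).coeff 1 =
      (∑ j : Fin 3, X j) * ((2 : ℝ) • (finSuccEquiv ℝ 3 A).coeff 2) := by
    rw [Finset.sum_mul, coeff_fse_sum, Finset.sum_mul]
    refine Finset.sum_congr rfl fun j _ => ?_
    rw [coeff_fse_X_succ_mul, coeff_fse_pderiv_zero]
    norm_num
  have h := congrArg (fun Q => (finSuccEquiv ℝ 3 Q).coeff 1) hgen
  simp only [map_zero, Polynomial.coeff_zero, map_sub, Polynomial.coeff_sub] at h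
  rw [e1, e2, h2] at h
  -- `h : D a - s * (-Δ a) = 0`
  rw [← h]
  ring

end Summit.QuantumFields.YangMills.Theorems.F4SubCurvatureDoorTorus

end
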